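import Summits.Parity.GeneralizedHardyLittlewood.Theses.VarianceWitness

/-!
# Birth skeleton (BC3) — crux stmt-Parity-17969 `Theses.VarianceWitness.InverseDicksonUniform` (rank 2, the door)
# line `birth`: the DILUTION DICHOTOMY — comparable bodies `#(K ∩ ℤ)·(log log N)^D ≥ N` (every `D`)
# versus short bodies, the short ones split again at bounded / large complexity `t`

Registered by the skeleton registrar (planner one-shot `planner-skel-stmt-Parity-17969-0`, 2026-08-17;
BC3 of `run/shared/lean/lens3/_common/BC.md`; route re-audit bin HONEST). Route
`route-Parity-VarianceWitness` (rev 13: `closes (hI : InverseDicksonUniform) (hV : TwistedVarianceRate) :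
GeneralizedHardyLittlewood`; this crux is its rank-2 binder and is wanted by no other route). Three NAMED
stubs and the kernel-checked composition `InverseDicksonUniform_of` concluding the crux BY NAME (axioms
`propext, Classical.choice, Quot.sound`); `inverseDicksonUniform_of_stubs` plugs the stubs in;
`crux_iff_stubs` (no `sorry`) shows the cut is an EQUIVALENCE — every stub is the crux restricted to a
sub-family of (body, complexity) pairs, so no stub is stronger than the crux and all three are load-bearing.

## The crux (FIXED; verbatim the route decl, rev 5 = LOCAL witness)

`InverseDicksonUniform`: for all `A, L` and `ε > 0` there are `κ, δ > 0` and `C, B, N₀ : ℕ` such that for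
`N ≥ N₀`, every `1 ≤ t ≤ (log log N)^A`, every non-degenerate `d = 1` system `Ψ` of `t` forms with
`‖Ψ‖_N ≤ L·t` and every convex `K ⊆ [−N, N]` carrying an ANOMALY
`ε(β_∞𝔖_Ψ + N) < |S_Ψ(K) − β_∞𝔖_Ψ|` (`S_Ψ(K) = vonMangoldtSum Ψ K N`, `β_∞ = archFactor Ψ K`,
`𝔖_Ψ = singularProduct Ψ`) there is a WITNESS at a comparable scale: `x ∈ [N, N^B]`, `1 ≤ q ≤ x^{1−κ}`,
`|τ| ≤ x` with `V_Λ(x; q, τ) ≥ δx²/(φ(q)(log log x)^C)`, where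
`V_Λ(x;q,τ) = Σ_{b mod q, (b,q)=1} |Σ_{n≤x, n≡b (q)} Λ(n)n^{−iτ} − (1/φ(q))Σ_{n≤x,(n,q)=1} Λ(n)n^{−iτ}|²`
(inlined Finset form; `= (1/φ(q)) Σ_{χ≠χ₀} |ψ(x,χ,τ)|²` by orthogonality).

## The cut — along the robustness frontier of the witness (dilution by `(#(K∩ℤ)/N)²`)

WHY THIS AXIS. The anomaly is normalised by `N` (the `+N`), but nothing in the crux ties the body `K` to
the scale: `S_Ψ(K) ≤ #(K∩ℤ)·(log 2LtN)^t` trivially and `≲ t^{O(t)}·𝔖_Ψ·#(K∩ℤ)` by an upper-bound sieve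
of dimension `t`, while `𝔖_Ψ ≤ (C log log N)^{t−1}` (landed:
`Theorems.AbsoluteUpgrade.stub_singularProduct_le_loglog_pow`). Hence for BOUNDED `t` an `ε`-anomaly
forces `#(K∩ℤ) ≥ c(t,L,ε)·N/(log log N)^{t−1}` — the body is comparable to the scale — but for
`t ≍ (log log N)^A` an anomaly may sit on a body as short as `N/F`, `F = exp((log log N)^{A+o(1)})`,
SUPER-polynomial in `log log N` (aligned systems `(n + jq)_{j<t}`, `P(t) ∣ q`, have `𝔖_Ψ ≍ (e^γ log t)^{t−1}`).
The witness, on the other hand, is a class variance of FULL sums `Σ_{n≤x}` twisted by `n^{−iτ}`: a relative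
bias `η` of the primes in the classes mod `q` on an interval of length `H` near `N` is seen by the twisted
full sums only through Mellin localisation `𝟙_{[x−H,x]}(n) ≈ ∫_{|τ|≲x/H'} ŵ(τ)(n/x)^{−iτ}dτ`, which
costs the factor `(H/x)²·(∫|ŵ|)²` in `V`, `∫|ŵ| = O(log(H/H'))` for a weight smoothed at scale `H'`
(Gallagher1970, Lemma 1; MontgomeryVaughan2007 §7.4). When `H ≥ N/(log log N)^D` and
`H' = N·exp(−(log log N)^{A+1})` absorbs the boundary layers, the total loss `(log log x)^{−2D−2A−2}`
is ABSORBED by the exponent `C` (which the crux lets depend on `A`, and the stub on `D`): the thesis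
"anomalies are character phenomena visible AT THEIR OWN SCALE" survives every world this seat could
construct (single real zero: calibration `C = 2A` of the route header; single off-axis zero
`ρ₀ = β₀ + iγ₀`: `ψ(x,χ,γ₀) ≈ −x^{β₀}/β₀`, full relative size at `τ = γ₀`; a Siegel zero: the folder
lemma `WitnessAtSiegelScales` of the route). When `H = N/F` with `F` super-polynomial in `log log N` it is
NOT absorbed, and there is a CONSISTENT conspiracy in which the crux fails on such bodies: `H_spread` =
"some `χ` of conductor `q ≤ N^{1−κ}` has `M ≥ F` zeros of `L(s,χ)`, all at depth
`(1−β) = log(Mt)/log N`, with ordinates `γ ∈ (2π/log N)·ℤ ∩ [−F, F]` (a vertical near-progression)"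
(permitted by the log-free density theorem `N(σ,T,χ) ≪ (qT)^{c(1−σ)}` as far as its exponent
`c > 1/(1−κ)` allows, IwaniecKowalski2004 Ch. 18, and by every zero-free region: `(1−β)log N = log(Mt) → ∞`):
the phases `N^{iγ}` align at `N`, so the primes in `[N − N/F, N]` are biased in the classes mod `q` by
`η = Σ_ρ N^{β−1} = M·(Mt)^{−1} = 1/t` (each zero contributes `N^{β−1} = 1/(Mt)`; the interval is short
enough, `|γ|·(N/F)/N ≤ 1`, for all `M` contributions to add), and the aligned `t`-system `(n + jq)_{j<t}`
(`P(t) ∣ q`, `𝔖_Ψ ≍ (e^γ log t)^{t−1} =: εF`) on `K = [N − N/F, N]` is `ε`-anomalous (`tη ≍ 1`); while for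
EVERY `x ∈ [N, N^B]` and `|τ| ≤ x` a twisted full sum `ψ(x,χ,τ)` catches only the zeros within `O(1)` of
`τ`, each of weight `x^{β−1} ≤ 1/(Mt)`: `|ψ(x,χ,τ)| ≲ x(1/(Mt))(log q + M log F/F)`, so
`V_Λ(x;q',τ) ≲ x²(log x)²/(t²F²φ(q'))` for every modulus `q'` (only the characters induced by `χ` are
abnormal) — below any `δx²/(φ(q')(log log x)^C)`.
So the corner "short body × large `t`" is exactly where a disprover should aim, and the cut isolates it;
the bounded-`t` short-body corner is PROVABLY empty (no anomalies), which is the line's first rung.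

* `stub_comparableBody` (C — the ROBUST CORE; OPEN, size: open-problem): the crux with one more
  uniformity parameter `D` joined to `(A, L)`: for all `A, L, D, ε` there are `(κ, δ, C, B, N₀)` such that
  … [crux hypotheses] … and `N ≤ #(K∩ℤ)·(log log N)^D` and an anomaly ⟹ the crux's witness. Contains the
  whole bounded-`t` content of the crux (there an anomaly forces a comparable body, see above) — in
  particular the PAIR case `t = 2`: "every twin- or Goldbach-type anomaly at scale `N` is GRH-lite-witnessed
  inside `[N, N^B]`", the first test case (item memo rbadge-g3 (4)) — and the `t`-uniform regime on
  comparable bodies, where the calibrating aligned-real-zero family lives (`K = [−N, N]`). Why plausible: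
  `S⁺ ⟹ C` (vacuity); in the illusory world and in every low-zeros world its conclusion is a theorem of the
  explicit formula with poly-`log log` losses only (the computation above); the intended engine is the
  structure theory of multiplicative functions transplanted to `Λ`-tuples (Tao's entropy decrement /
  inverse theorem, Tao–Teräväinen structure theorem, MRTTZ higher uniformity at natural density) plus the
  Pintz / Bhowmik–Grimmelt explicit formula for the major arcs of binary problems (anomaly ⟹ low-zero
  witness at the SAME scale with conductor a power of the scale is IN PRINT for `t = 2` on the major arcs:
  Pintz arXiv:1804.05561 Thm 9 / (1.29); BhowmikGrimmelt2026 Thm 6.3, Prop 8.1 — grounder notes g81-0/1 on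
  the item). Why it might fail: a pure-parity anomaly (λ non-pretentious; quiet class variance on the whole
  window) on a COMPARABLE body refutes it — the crux's declared bet, now free of the dilution artefact;
  known inverse theorems lose `exp(t)` in the number of forms and need log-averaging / EH-type level
  inputs at natural density. Sources: TaoFMP2016, TaoTeravainenDuke2019, TaoTeravainen2019AlmostAllScales,
  MatomakiEtAl2020, MatomakiMerikoski2023 (Thm 1.3), TaoTeravainen2021, HeathBrown1983PrimeTwins,
  BhowmikGrimmelt2026, arXiv:1804.05561, Gallagher1970 (Lemma 1), GoldstonSuriajaya2021 (§7).
* `stub_shortBodyBoundedT` (S_bdd — the FIRST RUNG; PROVABLE NOW, size L): for all `T, A, L, ε` there are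
  a floor `D` and `(κ, δ, C, B, N₀)` such that for `t ≤ T` (and the crux's `1 ≤ t ≤ (log log N)^A`),
  anomalies on bodies with `#(K∩ℤ)·(log log N)^D < N` are witnessed. Why plausible / how to prove: with
  `D = T` the anomaly hypothesis is eventually FALSE, so any witness clause holds vacuously —
  (excess) `S_Ψ(K) ≤ C(T,L)·#(K∩ℤ)·∏_{p<z}β_p(Ψ)·(FL factor) + o(N) ≤ C'·N(log log N)^{T−1−D} + o(N) < εN`
  by an upper-bound sieve of dimension `≤ T` for the values of a `d = 1` system on an integer interval
  (`K ∩ ℤ` IS an interval: convex ⟹ order-connected), uniform over `‖Ψ‖_N ≤ LT` (Fundamental Lemma,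
  landed as `Literature.NumberTheory.Sieve.SieveFrameworkFundamentalLemma` and already run over `d = 1`
  systems in `Theorems/DicksonFibrationDimOneStubPrimeSieve*.lean`; partial singular products bounded by
  the landed `Theorems.AbsoluteUpgrade.singularProductPartial_le_loglog_pow`; local obstruction `𝔖 = 0`
  by the landed `singularWeights_W2`); (deficit) `β_∞𝔖 ≤ (#(K∩ℤ)+1)·C(T,L)(log log N)^{T−1} < εN`
  (landed `stub_singularProduct_le_loglog_pow`; `β_∞ ≤ vol K ≤ #(K∩ℤ) + 1`). Why it might fail: only Lean
  size (value-interval bookkeeping for `a_i < 0`, prime powers below the sieve level, `archFactor` as a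
  volume). It is NOT bookkeeping for the line: it certifies that the dilution corner is EMPTY at every
  fixed complexity, i.e. that the danger is a `t → ∞` phenomenon. Sources: HalberstamRichert1974 (Thm 2.5,
  §5.7), FriedlanderIwaniecOpera2010 (Cor. 6.10, the Fundamental Lemma), GreenTao2010 ((1.6)–(1.7),
  Lemma 1.3), `Literature.NumberTheory.Sieve.twinSieveUpperBound_four` (the `t = 2` instance, landed).
* `stub_shortBodyLargeT` (S_large — the DILUTION CORNER; OPEN, possibly FALSE under `H_spread`; size:
  open-problem / disprover's target): for all `A, L, ε` there are a complexity threshold `t₀`, a floor `D`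
  and `(κ, δ, C, B, N₀)` such that for `t₀ ≤ t ≤ (log log N)^A`, anomalies on bodies with
  `#(K∩ℤ)·(log log N)^D < N` are witnessed in `[N, N^B]`. Two honest readings: (i) VACUOUS — short
  anomalies do not exist: an upper-bound sieve for `d = 1` systems UNIFORM in the dimension
  `t ≤ (log log N)^A` with total loss `(log log N)^{D}` instead of `t^{O(t)}𝔖_Ψ ≤ exp((log log N)^{A+o(1)})`
  — false for every sieve in print (Selberg's `Λ²` loses `2^t t!`), but nobody knows whether prime
  `t`-tuples CAN cluster by a factor `F ε/𝔖` on an interval of length `N/F`; (ii) INVERSE — they exist and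
  are witnessed: needs an input defeating the `(H/x)²` dilution, which the sup over `|τ| ≤ x` does not
  supply (computation above). Why it might fail: `H_spread → ¬ stub_shortBodyLargeT` is the EXPECTED
  disprover theorem (`stub_shortBodyLargeT_false_without_antiAP`: any proof must use a hypothesis
  excluding long vertical near-progressions of shallow zeros of ONE `L(s,χ)`); it would not touch C or
  S_bdd, and the repaired crux would be `C` itself (re-glue: `closes` uses the witness only through
  `TwistedVarianceRate`, which is body-free, so `C ∧ TwistedVarianceRate ⟹ S⁺ restricted to comparable
  bodies`, and the short-body half of `S⁺` is then a separate, sieve-flavoured item — flagged for the tenure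
  planner, NOT done here: the crux is fixed). Sources: IwaniecKowalski2004 (Ch. 18, log-free density;
  §10.5), MontgomeryVaughan2007 (§15.1, Ch. 12 explicit formula), Gallagher1970, FiorilliMartin2020 (size of
  `V_Λ` in known regimes), Literature.Barriers.Parity.EquidistributionLimits (Maier irregularity lives at
  length `(log N)^λ ≪ N/F`: not the obstruction here).

COMPOSITION `InverseDicksonUniform_of : C → S_bdd → S_large → InverseDicksonUniform` (REAL proof, this
file): given `(A, L, ε)` take `(t₀, D₂, κ₂, δ₂, C₂, B₂, N₂)` from S_large, `(D₃, κ₃, δ₃, C₃, B₃, N₃)` from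
S_bdd at `T := t₀`, and `(κ₁, δ₁, C₁, B₁, N₁)` from C at `D := max D₃ D₂`; answer with
`(min κᵢ, min δᵢ, max Cᵢ, max Bᵢ, max(Nᵢ, ⌈e^e⌉))`. For `N ≥ ⌈e^e⌉` one has `log log N ≥ 1`
(`one_le_loglog`), so `(log log N)^{Dᵢ} ≤ (log log N)^{D}` and a body short at floor `D` is short at both
floors; split on `N ≤ #(K∩ℤ)(log log N)^D` (`le_or_gt`) and then on `t < t₀` (`lt_or_ge`); a witness for any
of the three constant sets is a witness for the merged one (`hasWitness_mono`: `x^{1−κᵢ} ≤ x^{1−min κ}`,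
`N^{Bᵢ} ≤ N^{max B}`, `δᵢ/(φ(q)(log log x)^{Cᵢ}) ≥ (min δ)/(φ(q)(log log x)^{max C})` as `log log x ≥ 1`).
Conversely `stub_*_of_crux` (drop the extra hypotheses; `D := 0`, `t₀ := 0`), whence `crux_iff_stubs`.

HARDEST STUB: `stub_comparableBody` (it is the crux on the bodies that matter: open-problem strength,
twin-prime-inverse-hard already at `t = 2`, `t`-uniformity on top). The INFORMATIVE stubs — where a seat can
move this week — are `stub_shortBodyBoundedT` (prover: land it, L) and `stub_shortBodyLargeT` (disprover:
`_false_without_antiAP`). LOAD-BEARING: drop C and comparable bodies are uncovered; drop S_bdd and short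
bodies at `t < t₀` are uncovered; drop S_large and short bodies at large `t` are uncovered.

ALTERNATIVE CUTS considered and NOT registered. (a) The pure `t`-axis cut "`t ≤ T` for every `T`" ∧
"`∃ t₀`, `t ≥ t₀`": faithful and composable, but its large-`t` piece carries the dilution corner unflagged;
it survives here as the sub-cut of the short-body half, where it separates a theorem from a conjecture.
(b) The route header's chain `InversePretentiousUniform → PretentiousRigidity → crux`: NOT registered — by
orthogonality `V = (1/φ(q))Σ_{χ≠χ₀}|ψ(x,χ,τ)|²`, so for `φ(q) > (log log x)^C/δ` a witness NEEDS many
characters biased at once and a single-character / λ-pretentious middle node is a strict strengthening;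
and `λ` pretends only to REAL `χ` at `t ≈ 0` (`𝔻(1, χ²n^{2it})² ≤ 4𝔻(λ, χn^{it})²`), missing the
off-axis family the twist exists for (planner memo rbadge-g3 on the item, points (1)–(2)). (c) The memo's
MODEL split `MajorArcTrackingUniform → ModelAnomalyWitnessed → crux`: the right MECHANISM line, but it
needs a major-arc approximant `Λ♯` carrying ALL characters of conductor `≤ x^{1−κ}` — a level-`x^{1/2}`
circle-method dissection cannot see conductors in `(x^{1/2}, x^{1−κ}]`, and an exceptional character of
such a conductor `q` plausibly biases systems with shifts `≡ 0 (mod q)` (heuristic `Λ ≈ Λ_Siegel`; PROVED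
for conductors up to a small power of the scale: MatomakiMerikoski2023 Thm 1.3, HeathBrown1983PrimeTwins),
so "minor arcs negligible pointwise" is not a safe stub in a Siegel world — a definition request (`Λ♯`,
Tao–Teräväinen 2021 template with all exceptional characters), hence a crux-plan line, not a birth
skeleton. (d) A scale
transfer stub "variance witness at `y ∈ [N^{1/B}, N]` ⟹ witness at some `x ∈ [N, N^B]`": NOT registered —
false under the same `H_spread` (large values made by many shallow aligned zeros do not propagate upward
in scale), so it would plant a refutable stub in the core.

DISPROOF USED: none exists (`ledger crux ls stmt-Parity-17969`: no workfiles, 2026-08-17T13:3xZ) — no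
`_false_without_` obligations yet. The route's KILL CRITERIA expect `_false_without_C` (constant threshold)
and `_false_without_τ` (untwisted witness); all three stubs keep the crux's witness clause VERBATIM (decaying
threshold, twist, window `[N, N^B]`, `q ≤ x^{1−κ}`), so they honour both in advance; this file PROPOSES the
third: `stub_shortBodyLargeT_false_without_antiAP` (`H_spread` above). NEGATIVES
(`ledger negatives --problem Parity`, 3 entries): ConvMomentLevelOne (stmt-Parity-9541, sieve-sequence
moments), TupleElliott (stmt-Parity-14832: an exemption level fixed before `N` against shifts `|b| ≤ LN` —
"shift-divisor blindness"), RectangleChowla (stmt-Parity-4218) — none is a sub-case of the crux, so none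
meets a stub; the TupleElliott lesson (a quantity fixed before `N` versus data growing with `N`) is
respected: `D` and `t₀`, like `κ, δ, C, B`, are chosen after `(A, L, ε)` only, and the body condition scales
with `N`. DEAD LINES: none registered on this crux; the rev-3 body (witness at ANY `x ≥ N`,
stmt-Parity-18095) was kernel-checked `↔ (TwistedVarianceRate → S⁺)` — all stubs keep the rev-5 window.

BARRIERS (catalogue `Literature/Barriers/Parity`). `SiegelZeroPrimePairBarrier`, `SiegelZeroTwinPrimes`,
`BrunTitchmarshSiegelZero`, `SiegelZeroDichotomy*`: evaded by construction exactly as the crux — in the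
illusory world the conclusion of C and S_large is a theorem of the explicit formula (the Siegel character
has conductor `≤ x^{1−κ}` for `x = N²`, `B ≥ 2`) and S_bdd is hypothesis-free sieve theory; the Siegel
CONTENT of the route sits in crux 3. `SelbergParity`, `PrimePairParity`: C and S_large are `Λ`-specific
inverse statements, not sieve deductions from Type-I data — outside the classes (any proof opens `Λ`);
S_bdd IS a sieve upper bound, which the parity barrier permits (upper bounds with a constant are exactly
what sieves give). `LogarithmicAveraging`, `CircleMethodBinary` (true-complexity / binary barrier): NOT
evaded — natural density and infinite complexity are inherited from the crux (its declared bet); the cut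
does not pretend otherwise. `EquidistributionLimits` / `FriedlanderGranvilleUniformity` (Maier matrix):
not engaged — the short-body demand is an upper bound with room `F ε/𝔖`, not an asymptotic, and Maier
irregularity lives at length `(log N)^λ`, far below `N/F`.

CHEAPEST FALSIFIERS. Line as a whole: formalise `H_spread` as a hypothesis (zeros of one `L(s,χ)` as a
finite list with the stated depth/ordinate pattern, fed through the tree's explicit-formula vocabulary of
`Literature.Barriers.Parity.SiegelZeroPrimePairs*`) and prove `H_spread → ¬ stub_shortBodyLargeT` (kills
S_large only). For C: the in-print check that no Ω-theorem for `V_Λ` reaches relative size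
`(log log x)^{−C}` at `q ≤ x^{1−κ}` (RUN by the route planner: FiorilliMartin2020 Thm 1.2 lives at
`q ≍ log log x`; Friedlander–Granville irregularities need `q > x/(log x)^B`) — survives; and the `t = 2`
instance against TaoTeravainen2021 / MatomakiMerikoski2023 (anomalies there come WITH their witness).
For S_bdd: just prove it.

## BC3 audit (this seat, 2026-08-17)

`lean check --json` on this file: rc 0, `sorries` = 3 = the three `stub_*` (warnings "declaration uses
sorry" at the three stub declarations ONLY), zero elsewhere; `#print axioms InverseDicksonUniform_of` =
`[propext, Classical.choice, Quot.sound]` (no `sorryAx`); audit item `InverseDicksonUniform_of`: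
`proof.conditional`, target `Summit.Parity.GeneralizedHardyLittlewood.Theses.VarianceWitness.InverseDicksonUniform`
under exactly the three `Sig.stub_*` hypotheses. PROBES (folder `bc/` of the registrar, one file per
(stub, target), each importing ONLY the route file — this file is not imported, so no sibling stub or
`_of` theorem is in scope — with the stub signature pasted literally; `maxHeartbeats 400000`):
for every stub `S ∈ {stub_comparableBody, stub_shortBodyBoundedT, stub_shortBodyLargeT}` and target
`T ∈ {InverseDicksonUniform, GeneralizedHardyLittlewood}` the chain `first | exact? | simpa | aesop`
FAILS (rc 1), and run singly: `exact?` — "could not close the goal"; `aesop` — "failed to prove the goal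
after exhaustive search" (unsolved goal `⊢ T`); `simpa` — heartbeat timeout at 400k and "Tactic
`assumption` failed" at 4 000 000; the BC2-form chain `exact? | simpa [S] | (unfold S; simpa) | aesop`
through a named copy of the signature also FAILS. No stub is cheaply the crux or the summit (each misses a
(body, complexity) regime; the converse directions `crux → stub` are the trivial ones, proved below).
-/

set_option linter.dupNamespace false

noncomputable section

open scoped BigOperators Classical

namespace Summit.Parity.GeneralizedHardyLittlewood.Cruxes.InverseDicksonUniform.Birth

open Literature.NumberTheory.Sieve
open Summit.Parity.GeneralizedHardyLittlewood.Theses.VarianceWitness (InverseDicksonUniform)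

/-! ## Legend: the three stub statements as named propositions (verbatim the registered signatures) -/

/-- Statement of `stub_comparableBody` (C): the crux on bodies with `#(K∩ℤ)·(log log N)^D ≥ N`, every `D`. -/
def Sig.stub_comparableBody : Prop :=
  ∀ (A L D : ℕ), ∀ ε : ℝ, 0 < ε → ∃ κ : ℝ, 0 < κ ∧ ∃ δ : ℝ, 0 < δ ∧ ∃ C : ℕ, ∃ B : ℕ, ∃ N₀ : ℕ, ∀ N : ℕ, N₀ ≤ N → ∀ t : ℕ, 1 ≤ t → (t : ℝ) ≤ Real.log (Real.log N) ^ A → ∀ Ψ : Fin t → Literature.NumberTheory.Sieve.AffLinForm 1, Literature.NumberTheory.Sieve.IsNondegenerateSystem Ψ → Literature.NumberTheory.Sieve.affLinSize Ψ N ≤ L * t → ∀ K : Set (Fin 1 → ℝ), Convex ℝ K → K ⊆ Literature.NumberTheory.Sieve.realBox 1 N → (N : ℝ) ≤ ((((Literature.NumberTheory.Sieve.latticeBox 1 N).filter (fun n => Literature.NumberTheory.Sieve.realPoint n ∈ K)).card : ℕ) : ℝ) * Real.log (Real.log N) ^ D → ε * (Literature.NumberTheory.Sieve.archFactor Ψ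 K * Literature.NumberTheory.Sieve.singularProduct Ψ + N) < |Literature.NumberTheory.Sieve.vonMangoldtSum Ψ K N - Literature.NumberTheory.Sieve.archFactor Ψ K * Literature.NumberTheory.Sieve.singularProduct Ψ| → ∃ x : ℕ, N ≤ x ∧ x ≤ N ^ B ∧ ∃ q : ℕ, 1 ≤ q ∧ (q : ℝ) ≤ (x : ℝ) ^ (1 - κ) ∧ ∃ τ : ℝ, |τ| ≤ x ∧ δ * (x : ℝ) ^ 2 / ((Nat.totient q : ℝ) * Real.log (Real.log x) ^ C) ≤ ∑ b ∈ (Finset.range q).filter (fun b => Nat.Coprime b q), ‖(∑ n ∈ (Finset.Icc 1 x).filter (fun n => n % q = b), (ArithmeticFunction.vonMangoldt n : ℂ) * Complex.exp (-(τ * Real.log n) * Complex.I)) - (∑ n ∈ (Finset.Icc 1 x).filter (fun n => Nat.Coprime n q), (ArithmeticFunction.vonMangoldt n : ℂ) * Complex.exp (-(τ * Real.log n) * Complex.I)) / (Nat.totient q : ℂ)‖ ^ 2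

/-- Statement of `stub_shortBodyBoundedT` (S_bdd): the crux on short bodies, `#(K∩ℤ)·(log log N)^D < N` for
some floor `D`, at bounded complexity `t ≤ T`, every `T`. -/
def Sig.stub_shortBodyBoundedT : Prop :=
  ∀ (T A L : ℕ), ∀ ε : ℝ, 0 < ε → ∃ D : ℕ, ∃ κ : ℝ, 0 < κ ∧ ∃ δ : ℝ, 0 < δ ∧ ∃ C : ℕ, ∃ B : ℕ, ∃ N₀ : ℕ, ∀ N : ℕ, N₀ ≤ N → ∀ t : ℕ, 1 ≤ t → t ≤ T → (t : ℝ) ≤ Real.log (Real.log N) ^ A → ∀ Ψ : Fin t → Literature.NumberTheory.Sieve.AffLinForm 1, Literature.NumberTheory.Sieve.IsNondegenerateSystem Ψ → Literature.NumberTheory.Sieve.affLinSize Ψ N ≤ L * t → ∀ K : Set (Fin 1 → ℝ), Convex ℝ K → K ⊆ Literature.NumberTheory.Sieve.realBox 1 N → ((((Literature.NumberTheory.Sieve.latticeBox 1 N).filter (fun n => Literature.NumberTheory.Sieve.realPoint n ∈ K)).card : ℕ) : ℝ) * Real.log (Real.log N) ^ D < (N : ℝ) → ε * (Literature.NumberTheory.Sieve.archFactor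 Ψ K * Literature.NumberTheory.Sieve.singularProduct Ψ + N) < |Literature.NumberTheory.Sieve.vonMangoldtSum Ψ K N - Literature.NumberTheory.Sieve.archFactor Ψ K * Literature.NumberTheory.Sieve.singularProduct Ψ| → ∃ x : ℕ, N ≤ x ∧ x ≤ N ^ B ∧ ∃ q : ℕ, 1 ≤ q ∧ (q : ℝ) ≤ (x : ℝ) ^ (1 - κ) ∧ ∃ τ : ℝ, |τ| ≤ x ∧ δ * (x : ℝ) ^ 2 / ((Nat.totient q : ℝ) * Real.log (Real.log x) ^ C) ≤ ∑ b ∈ (Finset.range q).filter (fun b => Nat.Coprime b q), ‖(∑ n ∈ (Finset.Icc 1 x).filter (fun n => n % q = b), (ArithmeticFunction.vonMangoldt n : ℂ) * Complex.exp (-(τ * Real.log n) * Complex.I)) - (∑ n ∈ (Finset.Icc 1 x).filter (fun n => Nat.Coprime n q), (ArithmeticFunction.vonMangoldt n : ℂ) * Complex.exp (-(τ * Real.log n) * Complex.I)) / (Nat.totient q : ℂ)‖ ^ 2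

/-- Statement of `stub_shortBodyLargeT` (S_large): the crux on short bodies at complexity `t ≥ t₀`, for some
threshold `t₀` and floor `D`. -/
def Sig.stub_shortBodyLargeT : Prop :=
  ∀ (A L : ℕ), ∀ ε : ℝ, 0 < ε → ∃ t₀ : ℕ, ∃ D : ℕ, ∃ κ : ℝ, 0 < κ ∧ ∃ δ : ℝ, 0 < δ ∧ ∃ C : ℕ, ∃ B : ℕ, ∃ N₀ : ℕ, ∀ N : ℕ, N₀ ≤ N → ∀ t : ℕ, t₀ ≤ t → 1 ≤ t → (t : ℝ) ≤ Real.log (Real.log N) ^ A → ∀ Ψ : Fin t → Literature.NumberTheory.Sieve.AffLinForm 1, Literature.NumberTheory.Sieve.IsNondegenerateSystem Ψ → Literature.NumberTheory.Sieve.affLinSize Ψ N ≤ L * t → ∀ K : Set (Fin 1 → ℝ), Convex ℝ K → K ⊆ Literature.NumberTheory.Sieve.realBox 1 N → ((((Literature.NumberTheory.Sieve.latticeBox 1 N).filter (fun n => Literature.NumberTheory.Sieve.realPoint n ∈ K)).card : ℕ) : ℝ) * Real.log (Real.log N) ^ D < (N : ℝ) → ε * (Literature.NumberTheory.Sieve.archFactor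 Ψ K * Literature.NumberTheory.Sieve.singularProduct Ψ + N) < |Literature.NumberTheory.Sieve.vonMangoldtSum Ψ K N - Literature.NumberTheory.Sieve.archFactor Ψ K * Literature.NumberTheory.Sieve.singularProduct Ψ| → ∃ x : ℕ, N ≤ x ∧ x ≤ N ^ B ∧ ∃ q : ℕ, 1 ≤ q ∧ (q : ℝ) ≤ (x : ℝ) ^ (1 - κ) ∧ ∃ τ : ℝ, |τ| ≤ x ∧ δ * (x : ℝ) ^ 2 / ((Nat.totient q : ℝ) * Real.log (Real.log x) ^ C) ≤ ∑ b ∈ (Finset.range q).filter (fun b => Nat.Coprime b q), ‖(∑ n ∈ (Finset.Icc 1 x).filter (fun n => n % q = b), (ArithmeticFunction.vonMangoldt n : ℂ) * Complex.exp (-(τ * Real.log n) * Complex.I)) - (∑ n ∈ (Finset.Icc 1 x).filter (fun n => Nat.Coprime n q), (ArithmeticFunction.vonMangoldt n : ℂ) * Complex.exp (-(τ * Real.log n) * Complex.I)) / (Nat.totient q : ℂ)‖ ^ 2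

/-! ## Registered stubs (`sorry` only here; signatures def-free and self-contained) -/

/-- **C — COMPARABLE BODIES (the robust core; OPEN).** For all `A, L, D` and `ε > 0` there are `κ, δ > 0`
and `C, B, N₀` such that for `N ≥ N₀`, `1 ≤ t ≤ (log log N)^A`, every non-degenerate `d = 1` system `Ψ` of
`t` forms with `‖Ψ‖_N ≤ L·t`, every convex `K ⊆ [−N, N]` with `N ≤ #(K ∩ ℤ)·(log log N)^D` and an anomaly
`ε(β_∞𝔖 + N) < |S_Ψ(K) − β_∞𝔖|` admit the crux's witness: `x ∈ [N, N^B]`, `1 ≤ q ≤ x^(1−κ)`, `|τ| ≤ x`,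
`V_Λ(x;q,τ) ≥ δx²/(φ(q)(log log x)^C)`. The crux with the dilution `(#(K∩ℤ)/N)² ≥ (log log N)^(−2D)`
absorbable into `C`; contains every bounded-`t` case of the crux (pairs: `t = 2`) and the calibrating
aligned families. Why it might fail: a pure-parity anomaly on a comparable body (λ non-pretentious, quiet
twisted class variance on all of `[N, N^B]`); inverse theorems in print lose `exp(t)` and need
log-averaging. Sources: TaoFMP2016, TaoTeravainenDuke2019, TaoTeravainen2019AlmostAllScales,
MatomakiEtAl2020, MatomakiMerikoski2023, TaoTeravainen2021, BhowmikGrimmelt2026, arXiv:1804.05561,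
Gallagher1970, HeathBrown1983PrimeTwins. Size: open-problem. -/
theorem stub_comparableBody : ∀ (A L D : ℕ), ∀ ε : ℝ, 0 < ε → ∃ κ : ℝ, 0 < κ ∧ ∃ δ : ℝ, 0 < δ ∧ ∃ C : ℕ, ∃ B : ℕ, ∃ N₀ : ℕ, ∀ N : ℕ, N₀ ≤ N → ∀ t : ℕ, 1 ≤ t → (t : ℝ) ≤ Real.log (Real.log N) ^ A → ∀ Ψ : Fin t → Literature.NumberTheory.Sieve.AffLinForm 1, Literature.NumberTheory.Sieve.IsNondegenerateSystem Ψ → Literature.NumberTheory.Sieve.affLinSize Ψ N ≤ L * t → ∀ K : Set (Fin 1 → ℝ), Convex ℝ K → K ⊆ Literature.NumberTheory.Sieve.realBox 1 N → (N : ℝ) ≤ ((((Literature.NumberTheory.Sieve.latticeBox 1 N).filter (fun n => Literature.NumberTheory.Sieve.realPoint n ∈ K)).card : ℕ) : ℝ) * Real.log (Real.log N) ^ D → ε * (Literature.NumberTheory.Sieve.archFactor Ψ K * Literature.NumberTheory.Sieve.singularProduct Ψ + N) < |Literature.NumberTheory.Sieve.vonMangoldtSum Ψ K N - Literature.NumberTheory.Sieve.archFactor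 Ψ K * Literature.NumberTheory.Sieve.singularProduct Ψ| → ∃ x : ℕ, N ≤ x ∧ x ≤ N ^ B ∧ ∃ q : ℕ, 1 ≤ q ∧ (q : ℝ) ≤ (x : ℝ) ^ (1 - κ) ∧ ∃ τ : ℝ, |τ| ≤ x ∧ δ * (x : ℝ) ^ 2 / ((Nat.totient q : ℝ) * Real.log (Real.log x) ^ C) ≤ ∑ b ∈ (Finset.range q).filter (fun b => Nat.Coprime b q), ‖(∑ n ∈ (Finset.Icc 1 x).filter (fun n => n % q = b), (ArithmeticFunction.vonMangoldt n : ℂ) * Complex.exp (-(τ * Real.log n) * Complex.I)) - (∑ n ∈ (Finset.Icc 1 x).filter (fun n => Nat.Coprime n q), (ArithmeticFunction.vonMangoldt n : ℂ) * Complex.exp (-(τ * Real.log n) * Complex.I)) / (Nat.totient q : ℂ)‖ ^ 2 := by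
  sorry

/-- **S_bdd — SHORT BODIES AT BOUNDED COMPLEXITY (the first rung; PROVABLE NOW).** For all `T, A, L` and
`ε > 0` there are a floor `D` and `κ, δ > 0`, `C, B, N₀` such that for `N ≥ N₀`, `1 ≤ t ≤ T`,
`t ≤ (log log N)^A`, every non-degenerate `Ψ` of `t` forms with `‖Ψ‖_N ≤ L·t` and every convex `K ⊆ [−N, N]`
with `#(K ∩ ℤ)·(log log N)^D < N`, an anomaly yields the crux's witness. Expected proof (vacuity, `D = T`):
an upper-bound sieve of dimension `≤ T` on the integer interval `K ∩ ℤ` gives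
`S_Ψ(K) ≤ C(T,L)·#(K∩ℤ)·∏_(p<z) β_p + o(N) ≤ C'·N·(log log N)^(T−1−D) + o(N) < εN`, and
`β_∞𝔖 ≤ (#(K∩ℤ)+1)·C(T,L)(log log N)^(T−1) < εN` (landed: `stub_singularProduct_le_loglog_pow`,
`singularProductPartial_le_loglog_pow`, `singularWeights_W2`; Fundamental Lemma
`Literature.NumberTheory.Sieve.SieveFrameworkFundamentalLemma`), so no anomaly occurs for `N ≥ N₀`.
Why it might fail: Lean size only. Sources: HalberstamRichert1974 (Thm 2.5), FriedlanderIwaniecOpera2010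
(Cor. 6.10), GreenTao2010 (Lemma 1.3), Literature `twinSieveUpperBound_four`. Size: L. -/
theorem stub_shortBodyBoundedT : ∀ (T A L : ℕ), ∀ ε : ℝ, 0 < ε → ∃ D : ℕ, ∃ κ : ℝ, 0 < κ ∧ ∃ δ : ℝ, 0 < δ ∧ ∃ C : ℕ, ∃ B : ℕ, ∃ N₀ : ℕ, ∀ N : ℕ, N₀ ≤ N → ∀ t : ℕ, 1 ≤ t → t ≤ T → (t : ℝ) ≤ Real.log (Real.log N) ^ A → ∀ Ψ : Fin t → Literature.NumberTheory.Sieve.AffLinForm 1, Literature.NumberTheory.Sieve.IsNondegenerateSystem Ψ → Literature.NumberTheory.Sieve.affLinSize Ψ N ≤ L * t → ∀ K : Set (Fin 1 → ℝ), Convex ℝ K → K ⊆ Literature.NumberTheory.Sieve.realBox 1 N → ((((Literature.NumberTheory.Sieve.latticeBox 1 N).filter (fun n => Literature.NumberTheory.Sieve.realPoint n ∈ K)).card : ℕ) : ℝ) * Real.log (Real.log N) ^ D < (N : ℝ) → ε * (Literature.NumberTheory.Sieve.archFactor Ψ K * Literature.NumberTheory.Sieve.singularProduct Ψ + N) < |Literature.NumberTheory.Sieve.vonMangoldtSum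 Ψ K N - Literature.NumberTheory.Sieve.archFactor Ψ K * Literature.NumberTheory.Sieve.singularProduct Ψ| → ∃ x : ℕ, N ≤ x ∧ x ≤ N ^ B ∧ ∃ q : ℕ, 1 ≤ q ∧ (q : ℝ) ≤ (x : ℝ) ^ (1 - κ) ∧ ∃ τ : ℝ, |τ| ≤ x ∧ δ * (x : ℝ) ^ 2 / ((Nat.totient q : ℝ) * Real.log (Real.log x) ^ C) ≤ ∑ b ∈ (Finset.range q).filter (fun b => Nat.Coprime b q), ‖(∑ n ∈ (Finset.Icc 1 x).filter (fun n => n % q = b), (ArithmeticFunction.vonMangoldt n : ℂ) * Complex.exp (-(τ * Real.log n) * Complex.I)) - (∑ n ∈ (Finset.Icc 1 x).filter (fun n => Nat.Coprime n q), (ArithmeticFunction.vonMangoldt n : ℂ) * Complex.exp (-(τ * Real.log n) * Complex.I)) / (Nat.totient q : ℂ)‖ ^ 2 := by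
  sorry

/-- **S_large — SHORT BODIES AT LARGE COMPLEXITY (the dilution corner; OPEN, possibly false).** For all
`A, L` and `ε > 0` there are a threshold `t₀`, a floor `D` and `κ, δ > 0`, `C, B, N₀` such that for
`N ≥ N₀`, `t₀ ≤ t`, `1 ≤ t ≤ (log log N)^A`, every non-degenerate `Ψ` of `t` forms with `‖Ψ‖_N ≤ L·t` and
every convex `K ⊆ [−N, N]` with `#(K ∩ ℤ)·(log log N)^D < N`, an anomaly yields the crux's witness in
`[N, N^B]`. Either such anomalies do not exist (an upper-bound sieve UNIFORM in the dimension
`t ≤ (log log N)^A` with poly-`log log` loss — unknown) or they are witnessed despite the `(#(K∩ℤ)/N)²`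
dilution of twisted full-sum variances (no known input). Why it might fail: under `H_spread` (one
`L(s,χ)`, `cond χ ≤ N^(1−κ)`, with `M ≥ F` zeros at the common depth `log(Mt)/log N` whose ordinates lie
in `(2π/log N)ℤ ∩ [−F, F]`, hence aligned at `N`) the aligned system `(n + jq)_(j<t)` on
`K = [N − N/F, N]` is anomalous while every `V_Λ(x;q',τ)`, `x ∈ [N, N^B]`, `|τ| ≤ x`, stays below
threshold — expected disprover theorem `_false_without_antiAP`. Sources:
IwaniecKowalski2004 (Ch. 18), MontgomeryVaughan2007 (Ch. 12, §15.1), Gallagher1970, FiorilliMartin2020.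
Size: open-problem / disprover target. -/
theorem stub_shortBodyLargeT : ∀ (A L : ℕ), ∀ ε : ℝ, 0 < ε → ∃ t₀ : ℕ, ∃ D : ℕ, ∃ κ : ℝ, 0 < κ ∧ ∃ δ : ℝ, 0 < δ ∧ ∃ C : ℕ, ∃ B : ℕ, ∃ N₀ : ℕ, ∀ N : ℕ, N₀ ≤ N → ∀ t : ℕ, t₀ ≤ t → 1 ≤ t → (t : ℝ) ≤ Real.log (Real.log N) ^ A → ∀ Ψ : Fin t → Literature.NumberTheory.Sieve.AffLinForm 1, Literature.NumberTheory.Sieve.IsNondegenerateSystem Ψ → Literature.NumberTheory.Sieve.affLinSize Ψ N ≤ L * t → ∀ K : Set (Fin 1 → ℝ), Convex ℝ K → K ⊆ Literature.NumberTheory.Sieve.realBox 1 N → ((((Literature.NumberTheory.Sieve.latticeBox 1 N).filter (fun n => Literature.NumberTheory.Sieve.realPoint n ∈ K)).card : ℕ) : ℝ) * Real.log (Real.log N) ^ D < (N : ℝ) → ε * (Literature.NumberTheory.Sieve.archFactor Ψ K * Literature.NumberTheory.Sieve.singularProduct Ψ + N) < |Literature.NumberTheory.Sieve.vonMangoldtSum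 Ψ K N - Literature.NumberTheory.Sieve.archFactor Ψ K * Literature.NumberTheory.Sieve.singularProduct Ψ| → ∃ x : ℕ, N ≤ x ∧ x ≤ N ^ B ∧ ∃ q : ℕ, 1 ≤ q ∧ (q : ℝ) ≤ (x : ℝ) ^ (1 - κ) ∧ ∃ τ : ℝ, |τ| ≤ x ∧ δ * (x : ℝ) ^ 2 / ((Nat.totient q : ℝ) * Real.log (Real.log x) ^ C) ≤ ∑ b ∈ (Finset.range q).filter (fun b => Nat.Coprime b q), ‖(∑ n ∈ (Finset.Icc 1 x).filter (fun n => n % q = b), (ArithmeticFunction.vonMangoldt n : ℂ) * Complex.exp (-(τ * Real.log n) * Complex.I)) - (∑ n ∈ (Finset.Icc 1 x).filter (fun n => Nat.Coprime n q), (ArithmeticFunction.vonMangoldt n : ℂ) * Complex.exp (-(τ * Real.log n) * Complex.I)) / (Nat.totient q : ℂ)‖ ^ 2 := by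
  sorry

/-! ## In-file vocabulary for the composition (NOT used in the stub signatures) -/

/-- The twisted class variance `V_Λ(x; q, τ)` (verbatim the crux's inlined Finset expression). -/
def twistedClassVariance (x q : ℕ) (τ : ℝ) : ℝ :=
  ∑ b ∈ (Finset.range q).filter (fun b => Nat.Coprime b q), ‖(∑ n ∈ (Finset.Icc 1 x).filter (fun n => n % q = b), (ArithmeticFunction.vonMangoldt n : ℂ) * Complex.exp (-(τ * Real.log n) * Complex.I)) - (∑ n ∈ (Finset.Icc 1 x).filter (fun n => Nat.Coprime n q), (ArithmeticFunction.vonMangoldt n : ℂ) * Complex.exp (-(τ * Real.log n) * Complex.I)) / (Nat.totient q : ℂ)‖ ^ 2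

/-- The crux's witness clause with constants `(κ, δ, C, B)` at scale `N`. -/
def HasWitness (κ δ : ℝ) (C B N : ℕ) : Prop :=
  ∃ x : ℕ, N ≤ x ∧ x ≤ N ^ B ∧ ∃ q : ℕ, 1 ≤ q ∧ (q : ℝ) ≤ (x : ℝ) ^ (1 - κ) ∧ ∃ τ : ℝ, |τ| ≤ x ∧
    δ * (x : ℝ) ^ 2 / ((Nat.totient q : ℝ) * Real.log (Real.log x) ^ C) ≤ twistedClassVariance x q τ

/-- The lattice-point count `#(K ∩ ℤ ∩ [−N, N])` of a body (the index set of `vonMangoldtSum`). -/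
def latticeCount (K : Set (Fin 1 → ℝ)) (N : ℕ) : ℕ :=
  ((latticeBox 1 N).filter (fun n => realPoint n ∈ K)).card

/-- `log log x ≥ 1` once `x ≥ e^e`. -/
theorem one_le_loglog {x : ℝ} (hx : Real.exp (Real.exp 1) ≤ x) : 1 ≤ Real.log (Real.log x) := by
  have hxpos : (0 : ℝ) < x := lt_of_lt_of_le (Real.exp_pos _) hx
  have h1 : Real.exp 1 ≤ Real.log x := (Real.le_log_iff_exp_le hxpos).2 hx
  have hlogpos : 0 < Real.log x := lt_of_lt_of_le (Real.exp_pos _) h1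
  exact (Real.le_log_iff_exp_le hlogpos).2 h1

/-- Monotonicity of the witness threshold in `(δ, C)`: a smaller `δ` and a larger `C` only lower it
(needs `log log x ≥ 1`). -/
theorem threshold_mono {δ δ' ℓ φ X V : ℝ} {C C' : ℕ} (hδ : δ ≤ δ') (hδ0 : 0 ≤ δ) (hC : C' ≤ C)
    (hℓ : 1 ≤ ℓ) (hφ : 0 < φ) (h : δ' * X ^ 2 / (φ * ℓ ^ C') ≤ V) :
    δ * X ^ 2 / (φ * ℓ ^ C) ≤ V := by
  refine le_trans ?_ h
  have hden : (0 : ℝ) < φ * ℓ ^ C' := mul_pos hφ (pow_pos (by linarith) _)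
  apply div_le_div₀
  · exact mul_nonneg (hδ0.trans hδ) (sq_nonneg _)
  · exact mul_le_mul_of_nonneg_right hδ (sq_nonneg _)
  · exact hden
  · exact mul_le_mul_of_nonneg_left (pow_le_pow_right₀ hℓ hC) hφ.le

/-- Monotonicity of the whole witness clause in the constants: a witness for `(κ', δ', C', B')` is a
witness for any `κ ≤ κ'`, `0 ≤ δ ≤ δ'`, `C ≥ C'`, `B ≥ B'`, provided `N ≥ e^e` (so that `log log x ≥ 1`
and `N ≥ 1`). -/
theorem hasWitness_mono {κ κ' δ δ' : ℝ} {C C' B B' N : ℕ} (hκ : κ ≤ κ') (hδ : δ ≤ δ') (hδ0 : 0 ≤ δ)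
    (hC : C' ≤ C) (hB : B' ≤ B) (hN : Real.exp (Real.exp 1) ≤ (N : ℝ)) :
    HasWitness κ' δ' C' B' N → HasWitness κ δ C B N := by
  rintro ⟨x, hNx, hxB, q, hq, hqκ, τ, hτ, hV⟩
  have hxe : Real.exp (Real.exp 1) ≤ (x : ℝ) := hN.trans (by exact_mod_cast hNx)
  have hx1 : (1 : ℝ) ≤ x := le_trans (Real.one_le_exp (Real.exp_pos 1).le) hxe
  have hNpos : 0 < N := by
    have h0 : (0 : ℝ) < N := lt_of_lt_of_le (Real.exp_pos _) hN
    exact_mod_cast h0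
  have hφ : (0 : ℝ) < (Nat.totient q : ℝ) := by exact_mod_cast Nat.totient_pos.mpr (by omega)
  refine ⟨x, hNx, hxB.trans (Nat.pow_le_pow_right hNpos hB), q, hq,
    hqκ.trans (Real.rpow_le_rpow_of_exponent_le hx1 (by linarith)), τ, hτ, ?_⟩
  exact threshold_mono hδ hδ0 hC (one_le_loglog hxe) hφ hV

/-- A body short at floor `D` is short at any floor `D' ≤ D` (once `log log N ≥ 1`). -/
theorem short_of_short {c ℓ n : ℝ} {D D' : ℕ} (hc : 0 ≤ c) (hℓ : 1 ≤ ℓ) (hD : D' ≤ D)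
    (h : c * ℓ ^ D < n) : c * ℓ ^ D' < n :=
  lt_of_le_of_lt (mul_le_mul_of_nonneg_left (pow_le_pow_right₀ hℓ hD) hc) h

/-! ## Composition: the crux BY NAME from the three stubs (real proof, no `sorry`) -/

/-- **InverseDicksonUniform from the three regimes.** Given `(A, L, ε)`: `(t₀, D₂, …)` from S_large,
`(D₃, …)` from S_bdd at `T := t₀`, `(κ₁, …)` from C at `D := max D₃ D₂`; answer with
`(min κᵢ, min δᵢ, max Cᵢ, max Bᵢ, max(Nᵢ, ⌈e^e⌉))`; split on `N ≤ #(K∩ℤ)(log log N)^D`, then on `t < t₀`. -/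
theorem InverseDicksonUniform_of :
    Sig.stub_comparableBody → Sig.stub_shortBodyBoundedT → Sig.stub_shortBodyLargeT →
      InverseDicksonUniform := by
  intro hcmp hbdd hlarge A L ε hε
  obtain ⟨t₀, D₂, κ₂, hκ₂, δ₂, hδ₂, C₂, B₂, N₂, h₂⟩ := hlarge A L ε hε
  obtain ⟨D₃, κ₃, hκ₃, δ₃, hδ₃, C₃, B₃, N₃, h₃⟩ := hbdd t₀ A L ε hε
  obtain ⟨κ₁, hκ₁, δ₁, hδ₁, C₁, B₁, N₁, h₁⟩ := hcmp A L (max D₃ D₂) ε hε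
  refine ⟨min κ₁ (min κ₂ κ₃), lt_min hκ₁ (lt_min hκ₂ hκ₃), min δ₁ (min δ₂ δ₃),
    lt_min hδ₁ (lt_min hδ₂ hδ₃), max C₁ (max C₂ C₃), max B₁ (max B₂ B₃),
    max (max N₁ (max N₂ N₃)) ⌈Real.exp (Real.exp 1)⌉₊, ?_⟩
  intro N hN t ht htA Ψ hΨ hL K hK hKN hanom
  have hN₁ : N₁ ≤ N := le_trans (le_trans (le_max_left _ _) (le_max_left _ _)) hN
  have hN₂ : N₂ ≤ N :=
    le_trans (le_trans (le_trans (le_max_left _ _) (le_max_right _ _)) (le_max_left _ _)) hN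
  have hN₃ : N₃ ≤ N :=
    le_trans (le_trans (le_trans (le_max_right _ _) (le_max_right _ _)) (le_max_left _ _)) hN
  have hNe : Real.exp (Real.exp 1) ≤ (N : ℝ) :=
    (Nat.le_ceil _).trans (by exact_mod_cast le_trans (le_max_right _ _) hN)
  have hℓ : 1 ≤ Real.log (Real.log (N : ℝ)) := one_le_loglog hNe
  have hδ0 : (0 : ℝ) ≤ min δ₁ (min δ₂ δ₃) := (lt_min hδ₁ (lt_min hδ₂ hδ₃)).le
  change HasWitness (min κ₁ (min κ₂ κ₃)) (min δ₁ (min δ₂ δ₃)) (max C₁ (max C₂ C₃))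
    (max B₁ (max B₂ B₃)) N
  rcases le_or_gt (N : ℝ)
      ((((latticeBox 1 N).filter (fun n => realPoint n ∈ K)).card : ℝ) *
        Real.log (Real.log (N : ℝ)) ^ (max D₃ D₂)) with hlong | hshort
  · -- comparable body: regime C
    have hw : HasWitness κ₁ δ₁ C₁ B₁ N := h₁ N hN₁ t ht htA Ψ hΨ hL K hK hKN hlong hanom
    exact hasWitness_mono (min_le_left _ _) (min_le_left _ _) hδ0 (le_max_left _ _)
      (le_max_left _ _) hNe hw
  · have hc : (0 : ℝ) ≤ (((latticeBox 1 N).filter (fun n => realPoint n ∈ K)).card : ℝ) :=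
      Nat.cast_nonneg _
    rcases lt_or_ge t t₀ with hlt | hge
    · -- short body, bounded complexity: regime S_bdd (floor `D₃ ≤ max D₃ D₂`)
      have hshort₃ := short_of_short hc hℓ (le_max_left D₃ D₂) hshort
      have hw : HasWitness κ₃ δ₃ C₃ B₃ N :=
        h₃ N hN₃ t ht hlt.le htA Ψ hΨ hL K hK hKN hshort₃ hanom
      exact hasWitness_mono ((min_le_right _ _).trans (min_le_right _ _))
        ((min_le_right _ _).trans (min_le_right _ _)) hδ0
        ((le_max_right _ _).trans (le_max_right _ _))
        ((le_max_right _ _).trans (le_max_right _ _)) hNe hw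
    · -- short body, large complexity: regime S_large (floor `D₂ ≤ max D₃ D₂`)
      have hshort₂ := short_of_short hc hℓ (le_max_right D₃ D₂) hshort
      have hw : HasWitness κ₂ δ₂ C₂ B₂ N :=
        h₂ N hN₂ t hge ht htA Ψ hΨ hL K hK hKN hshort₂ hanom
      exact hasWitness_mono ((min_le_right _ _).trans (min_le_left _ _))
        ((min_le_right _ _).trans (min_le_left _ _)) hδ0
        ((le_max_left _ _).trans (le_max_right _ _))
        ((le_max_left _ _).trans (le_max_right _ _)) hNe hw

/-- The crux by name, closed modulo the three registered stubs (checks that the `Sig.*` legend is the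
stub signatures verbatim). -/
theorem inverseDicksonUniform_of_stubs : InverseDicksonUniform :=
  InverseDicksonUniform_of stub_comparableBody stub_shortBodyBoundedT stub_shortBodyLargeT

/-! ## Sanity (no `sorry`): each stub is a CONSEQUENCE of the crux — the cut is an equivalence -/

/-- Regime C is the crux restricted to a sub-family of bodies. -/
theorem stub_comparableBody_of_crux (h : InverseDicksonUniform) : Sig.stub_comparableBody := by
  intro A L D ε hε
  obtain ⟨κ, hκ, δ, hδ, C, B, N₀, hN₀⟩ := h A L ε hε
  exact ⟨κ, hκ, δ, hδ, C, B, N₀, fun N hN t ht htA Ψ hΨ hL K hK hKN _ hanom =>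
    hN₀ N hN t ht htA Ψ hΨ hL K hK hKN hanom⟩

/-- Regime S_bdd is the crux restricted to a sub-family of (body, complexity) pairs (any floor). -/
theorem stub_shortBodyBoundedT_of_crux (h : InverseDicksonUniform) : Sig.stub_shortBodyBoundedT := by
  intro T A L ε hε
  obtain ⟨κ, hκ, δ, hδ, C, B, N₀, hN₀⟩ := h A L ε hε
  exact ⟨0, κ, hκ, δ, hδ, C, B, N₀, fun N hN t ht _ htA Ψ hΨ hL K hK hKN _ hanom =>
    hN₀ N hN t ht htA Ψ hΨ hL K hK hKN hanom⟩

/-- Regime S_large is the crux restricted to a sub-family of (body, complexity) pairs (any `t₀`, `D`). -/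
theorem stub_shortBodyLargeT_of_crux (h : InverseDicksonUniform) : Sig.stub_shortBodyLargeT := by
  intro A L ε hε
  obtain ⟨κ, hκ, δ, hδ, C, B, N₀, hN₀⟩ := h A L ε hε
  exact ⟨0, 0, κ, hκ, δ, hδ, C, B, N₀, fun N hN t _ ht htA Ψ hΨ hL K hK hKN _ hanom =>
    hN₀ N hN t ht htA Ψ hΨ hL K hK hKN hanom⟩

/-- The cut is faithful:
`InverseDicksonUniform ↔ stub_comparableBody ∧ stub_shortBodyBoundedT ∧ stub_shortBodyLargeT`. -/
theorem crux_iff_stubs :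
    InverseDicksonUniform ↔
      (Sig.stub_comparableBody ∧ Sig.stub_shortBodyBoundedT ∧ Sig.stub_shortBodyLargeT) :=
  ⟨fun h => ⟨stub_comparableBody_of_crux h, stub_shortBodyBoundedT_of_crux h,
      stub_shortBodyLargeT_of_crux h⟩,
    fun h => InverseDicksonUniform_of h.1 h.2.1 h.2.2⟩

end Summit.Parity.GeneralizedHardyLittlewood.Cruxes.InverseDicksonUniform.Birth

end
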